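import Summits.KontsevichZagierPeriods.KontsevichZagierPeriods.Theorems.UnfoldedStokesCubeKernelStepStubDerivativeMarginal

/-!
# `CubeKernelStep` (stmt-KontsevichZagierPeriods-17854), line `Sketch`:
# stub `stub_semialgebraicMarginal`

The RUNG stub `stub_semialgebraicMarginal` (a K2-instance, wave 4) of the skeleton
`Cruxes/CubeKernelStep/Lines/Sketch.lean` of the crux `CubeKernelStep` (route UnfoldedStokes):
under the lower layers `K(≤d)` (`d ≥ 1`), a continuous closed `(d+1)`-cube representation `t` of
value `0` whose marginal `sliceValue t` agrees on `[0,1]` with a function `W` that is continuous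
and `ℚ`-semialgebraic on `[0,1]` is congruent modulo `KZ.relations` to a continuous FIBRE-NULL
closed `(d+1)`-cube representation `t'`.

Proof. WITNESS `t'(z) = t(z) − W(z 0)` (continuous and `ℚ`-semialgebraic on the closed cube:
`W ∘ pr₀` is the composite of the semialgebraic `W` with a coordinate projection).
(A) `t'` is fibre-null: for `s ∈ [0,1]` the slice of `t'` over `z 0 = s` is the `d`-cube and its
slice value is `sliceValue t s − W(s) · vol([0,1]^d) = W(s) − W(s) = 0`.
(B) Integrand additivity (rule (1)): `[t] − [t'] − [g] ∈ relations` with `g = [□^{d+1}, W(z 0)]`.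
(C) `g` is congruent to the LIFT (`exists_liftCube 1 (d+1)`, silent coordinates `1, …, d`,
rule (3)) of the interval representation `h = [[0,1], W]`.
(D) `h.value = ∫₀¹ W = ∫₀¹ sliceValue t = ∫ sliceValue t = t.value = 0` (Fubini over the
parameter), so `K(≤d)` at `M = 1 ≤ d` kills `[h]`, hence `[g]`, hence `[t] − [t']`.
[Kontsevich–Zagier 2001, §1.2 rules (1), (3)]
-/

noncomputable section

set_option linter.dupNamespace false

namespace Summit.KontsevichZagierPeriods.KontsevichZagierPeriods.Cruxes.CubeKernelStep.Layers

open MeasureTheory Set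
open Literature.ModelTheory.ExponentialFields (IsSemialgebraic)
open Literature.NumberTheory.Transcendental
open Literature.NumberTheory.Transcendental.KZ
open Summit.KontsevichZagierPeriods.KontsevichZagierPeriods.Cruxes.StokesGeneration.FibrewiseStokes
  (setIntegral_cubePi_comp_eval)
open Summit.KontsevichZagierPeriods.KontsevichZagierPeriods.StokesGenerationLine
  (exists_liftCube isSemialgebraic_cubePi)

/-- The closed `1`-cube `Set.pi univ (fun _ => [0,1])` is the order interval `[0,1]` of
`ℝ¹ = (Fin 1 → ℝ)`. [folklore] -/
theorem sam_cubePi_one_eq_Icc :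
    Set.pi Set.univ (fun _ : Fin 1 => Set.Icc (0:ℝ) 1) = Set.Icc (0 : Fin 1 → ℝ) 1 :=
  Set.pi_univ_Icc (0 : Fin 1 → ℝ) 1

/-- For `W` continuous on `[0,1]` with `y ↦ W (y 0)` `ℚ`-semialgebraic on `[0,1] ⊆ ℝ¹`, the
function `z ↦ W (z i)` of one coordinate is `ℚ`-semialgebraic (composite with the coordinate
projection `z ↦ (z i) ∈ ℝ¹`, Tarski–Seidenberg) and continuous on the closed `n`-cube.
[cite: BochnakCosteRoy1998, Prop. 2.2.6] -/
theorem sam_comp_eval {n : ℕ} {W : ℝ → ℝ} (hWc : ContinuousOn W (Set.Icc (0:ℝ) 1))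
    (hWs : IsSemialgebraicFunOn ℚ (Set.Icc (0 : Fin 1 → ℝ) 1) (fun y => W (y 0))) (i : Fin n) :
    IsSemialgebraicFunOn ℚ (Set.pi Set.univ (fun _ : Fin n => Set.Icc (0:ℝ) 1))
        (fun z => W (z i)) ∧
      ContinuousOn (fun z : Fin n → ℝ => W (z i))
        (Set.pi Set.univ (fun _ : Fin n => Set.Icc (0:ℝ) 1)) := by
  have hQ : IsSemialgebraic ℚ (Set.pi Set.univ (fun _ : Fin n => Set.Icc (0:ℝ) 1)) :=
    isSemialgebraic_cubePi n
  have hmem : MapsTo (fun (z : Fin n → ℝ) (_ : Fin 1) => z i)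
      (Set.pi Set.univ (fun _ : Fin n => Set.Icc (0:ℝ) 1)) (Set.Icc (0 : Fin 1 → ℝ) 1) := by
    intro z hz
    rw [← sam_cubePi_one_eq_Icc]
    exact derivMarg_const_mem_cubePi_one (hz i (Set.mem_univ _))
  have hmap : IsSemialgebraicMapOn ℚ (Set.pi Set.univ (fun _ : Fin n => Set.Icc (0:ℝ) 1))
      (fun (z : Fin n → ℝ) (_ : Fin 1) => z i) :=
    IsSemialgebraicMapOn.of_forall hQ fun _ => isSemialgebraicFunOn_apply hQ i
  exact ⟨IsSemialgebraicFunOn.comp_isSemialgebraicMapOn_holds hWs hmap hmem,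
    hWc.comp (continuous_apply i).continuousOn fun z hz => hz i (Set.mem_univ _)⟩

/-- **The witness is fibre-null.** If the slice values of `t` over `z 0` agree with `W` on
`[0,1]`, the closed-cube representation `t'` with integrand `t(z) − W(z 0)` has slice value
`W(s) − W(s) · vol([0,1]^d) = 0` at every `s ∈ [0,1]`. [cite: KontsevichZagier2001, §1.2] -/
theorem sam_sliceValue_witness {d : ℕ} (t t' : IntegralRep (d + 1)) (W : ℝ → ℝ)
    (htd : t.domain = Set.pi Set.univ (fun _ : Fin (d + 1) => Set.Icc (0:ℝ) 1))
    (htc : ContinuousOn t.integrand t.domain)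
    (ht'd : t'.domain = Set.pi Set.univ (fun _ : Fin (d + 1) => Set.Icc (0:ℝ) 1))
    (ht'i : t'.integrand = fun z => t.integrand z - W (z 0))
    (hslice : ∀ s ∈ Set.Icc (0:ℝ) 1, sliceValue t s = W s)
    {s : ℝ} (hs : s ∈ Set.Icc (0:ℝ) 1) : sliceValue t' s = 0 := by
  have hmeas : MeasurableSet (Set.pi Set.univ (fun _ : Fin d => Set.Icc (0:ℝ) 1)) :=
    MeasurableSet.univ_pi fun _ => measurableSet_Icc
  have hQc : IsCompact (Set.pi Set.univ (fun _ : Fin d => Set.Icc (0:ℝ) 1)) :=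
    isCompact_univ_pi fun _ => isCompact_Icc
  have hvol : (volume : Measure (Fin d → ℝ)).real
      (Set.pi Set.univ (fun _ : Fin d => Set.Icc (0:ℝ) 1)) = 1 := by
    rw [← cube_eq_pi]
    exact volume_real_cube
  rw [htd] at htc
  have hcs : ContinuousOn (fun x : Fin d → ℝ => t.integrand (Matrix.vecCons s x))
      (Set.pi Set.univ (fun _ : Fin d => Set.Icc (0:ℝ) 1)) :=
    htc.comp (continuous_const.matrixVecCons continuous_id).continuousOn
      fun x hx => derivMarg_vecCons_mem_cubePi hs hx
  have hWi : IntegrableOn (fun _ : Fin d → ℝ => W s)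
      (Set.pi Set.univ (fun _ : Fin d => Set.Icc (0:ℝ) 1)) :=
    continuousOn_const.integrableOn_compact hQc
  have hEq : EqOn (fun x : Fin d → ℝ => t'.integrand (Matrix.vecCons s x))
      (fun x => t.integrand (Matrix.vecCons s x) - W s)
      (Set.pi Set.univ (fun _ : Fin d => Set.Icc (0:ℝ) 1)) := by
    intro x _
    simp only [ht'i, Matrix.cons_val_zero]
  have h1 : ∫ x in Set.pi Set.univ (fun _ : Fin d => Set.Icc (0:ℝ) 1),
      t.integrand (Matrix.vecCons s x) = W s := by
    rw [← hslice s hs, sliceValue_def, finRank_slice_eq_cube t htd hs]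
  rw [sliceValue_def, finRank_slice_eq_cube t' ht'd hs, setIntegral_congr_fun hmeas hEq,
    integral_sub (hcs.integrableOn_compact hQc) hWi, h1, setIntegral_const, hvol, one_smul,
    sub_self]

/-- **Value of the interval representation `[[0,1], W]`.** If the slice values of the closed
`(d+1)`-cube representation `t` agree with `W` on `[0,1]`, then the `1`-cube representation with
integrand `y ↦ W (y 0)` has value `∫₀¹ W = ∫ sliceValue t = t.value` (the slice function vanishes
off `[0,1]`; Fubini over the parameter coordinate). [cite: KontsevichZagier2001, §1.2] -/
theorem sam_value_interval {d : ℕ} (t : IntegralRep (d + 1)) (h : IntegralRep 1) (W : ℝ → ℝ)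
    (htd : t.domain = Set.pi Set.univ (fun _ : Fin (d + 1) => Set.Icc (0:ℝ) 1))
    (hWc : ContinuousOn W (Set.Icc (0:ℝ) 1))
    (hslice : ∀ s ∈ Set.Icc (0:ℝ) 1, sliceValue t s = W s)
    (hhd : h.domain = Set.pi Set.univ (fun _ : Fin 1 => Set.Icc (0:ℝ) 1))
    (hhi : h.integrand = fun y => W (y 0)) : h.value = t.value := by
  have e1 : h.value = ∫ u in Set.Icc (0:ℝ) 1, W u := by
    rw [← setIntegral_cubePi_comp_eval (0 : Fin 1) (hWc.aestronglyMeasurable measurableSet_Icc),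
      IntegralRep.value, hhd, hhi]
  rw [e1, setIntegral_congr_fun measurableSet_Icc (fun u hu => (hslice u hu).symm),
    setIntegral_eq_integral_of_forall_compl_eq_zero
      (fun s hs => sliceValue_eq_zero_of_not_mem t htd hs),
    integral_sliceValue]

/-- RUNG (a K2-instance, wave 4) of crux `CubeKernelStep`, line `Sketch`: **a semialgebraic
marginal is realised and removed.** Under `K(≤d)` (`d ≥ 1`), if `t` is a continuous closed
`(d+1)`-cube representation of value `0` whose slice values over `z 0` agree on `[0,1]` with a
function `W` that is continuous and `ℚ`-semialgebraic on `[0,1]`, then `t` is congruent modulo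
`relations` to a continuous FIBRE-NULL closed `(d+1)`-cube representation: `t'(z) := t(z) − W(z 0)`;
the difference `[□^{d+1}, W(z 0)]` is the lift of `[[0,1], W]` (silent coordinates `1, …, d`,
`exists_liftCube 1 (d+1)`), a continuous interval representation of value
`∫₀¹ W = ∫ sliceValue t = t.value = 0`, killed by `K(≤1)`.
[cite: KontsevichZagier2001, §1.2 rules (1), (3)] -/
theorem stub_semialgebraicMarginal :
    ∀ d : ℕ, 1 ≤ d →
      (∀ (M : ℕ), M ≤ d → ∀ (a : IntegralRep M),
        a.domain = Set.pi Set.univ (fun _ : Fin M => Set.Icc (0:ℝ) 1) →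
        ContinuousOn a.integrand a.domain → a.value = 0 → of a ∈ relations) →
      ∀ (t : IntegralRep (d + 1)) (W : ℝ → ℝ),
        t.domain = Set.pi Set.univ (fun _ : Fin (d + 1) => Set.Icc (0:ℝ) 1) →
        ContinuousOn t.integrand t.domain → t.value = 0 →
        ContinuousOn W (Set.Icc (0:ℝ) 1) →
        IsSemialgebraicFunOn ℚ (Set.Icc (0 : Fin 1 → ℝ) 1) (fun y => W (y 0)) →
        (∀ s ∈ Set.Icc (0:ℝ) 1, sliceValue t s = W s) →
        ∃ t' : IntegralRep (d + 1),
          t'.domain = Set.pi Set.univ (fun _ : Fin (d + 1) => Set.Icc (0:ℝ) 1) ∧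
          ContinuousOn t'.integrand t'.domain ∧
          (∀ s ∈ Set.Icc (0:ℝ) 1, sliceValue t' s = 0) ∧
          of t - of t' ∈ relations := by
  intro d hd hK t W htd htc hval hWc hWs hslice
  classical
  have htS : IsSemialgebraicFunOn ℚ (Set.pi Set.univ (fun _ : Fin (d + 1) => Set.Icc (0:ℝ) 1))
      t.integrand := by
    rw [← htd]; exact t.isSemialgebraicFunOn_integrand
  have htC : ContinuousOn t.integrand
      (Set.pi Set.univ (fun _ : Fin (d + 1) => Set.Icc (0:ℝ) 1)) := by
    rw [← htd]; exact htc
  -- the removed piece `g = [□^{d+1}, W(z 0)]` and the witness `t' = [□^{d+1}, t(z) − W(z 0)]`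
  obtain ⟨hGS, hGC⟩ := sam_comp_eval hWc hWs (0 : Fin (d + 1))
  obtain ⟨t', ht'd, ht'i⟩ := derivMarg_exists_rep (htS.fun_sub hGS) (htC.sub hGC)
  obtain ⟨g, hgd, hgi⟩ := derivMarg_exists_rep hGS hGC
  -- (A) the witness is fibre-null and continuous
  have hfn : ∀ s ∈ Set.Icc (0:ℝ) 1, sliceValue t' s = 0 := fun s hs =>
    sam_sliceValue_witness t t' W htd htc ht'd ht'i hslice hs
  have ht'C : ContinuousOn t'.integrand t'.domain := by
    rw [ht'd, ht'i]; exact htC.sub hGC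
  refine ⟨t', ht'd, ht'C, hfn, ?_⟩
  -- (B) integrand additivity: `[t] − [t'] − [g] ∈ relations`
  have e1 : of t - of t' - of g ∈ relations :=
    integrandAddRel_subset_relations ⟨d + 1, t, t', g, ht'd.trans htd.symm, hgd.trans htd.symm,
      fun x _ => by simp only [ht'i, hgi, Pi.add_apply]; ring, rfl⟩
  -- (C) `g` is congruent to the lift `L` of the interval representation `h = [[0,1], W]`
  obtain ⟨hhS, hhC⟩ := sam_comp_eval hWc hWs (0 : Fin 1)
  obtain ⟨h, hhd, hhi⟩ := derivMarg_exists_rep hhS hhC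
  have h1le : 1 ≤ d + 1 := by omega
  obtain ⟨L, hLd, hLi, e2⟩ := exists_liftCube 1 (d + 1) h1le h hhd
  have hκ0 : (Fin.castLE h1le 0 : Fin (d + 1)) = 0 := Fin.ext rfl
  have e3 : of g - of L ∈ relations := by
    refine of_sub_of_mem_relations_of_eqOn (hLd.trans hgd.symm) fun x hx => ?_
    rw [hgd] at hx
    simp only [hLi x hx, hgi, hhi, hκ0]
  -- (D) `h.value = ∫₀¹ W = ∫ sliceValue t = t.value = 0`, killed by `K(≤ d)` at `M = 1`
  have hhval : h.value = 0 := (sam_value_interval t h W htd hWc hslice hhd hhi).trans hval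
  have hhC' : ContinuousOn h.integrand h.domain := by
    rw [hhd, hhi]; exact hhC
  have e4 : of h ∈ relations := hK 1 hd h hhd hhC' hhval
  have key : of t - of t' = (of t - of t' - of g) + (of g - of L) - (of h - of L) + of h := by
    abel
  rw [key]
  exact relations.add_mem (relations.sub_mem (relations.add_mem e1 e3) e2) e4

end Summit.KontsevichZagierPeriods.KontsevichZagierPeriods.Cruxes.CubeKernelStep.Layers

end
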